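/-
Copyright (c) 2026 the pub-hodgecm-mathlib formalisation cell (harness21).  Prover seat hodgecm-mathlib-R90-C133-p02 (g0), Track B ∕ R90-TF, h413 = `stmt-HodgeConjecture-24833`,
R90-TF section S8 «ContSpec-n½» (S8-R128 (9) ∕ S8-R131 (1) «T-disc-1 FILE 2», census `R90/S8/CENSUS-MidBlockLevelFinite.R90-C133-p02-g0.md`): THE MIDDLE-POLE RESIDUE ATOMS
`resGMidAtom ξ μω K′ ω` OF `L²(U_{L∕L⁺}(3))` ARE FINITE-DIMENSIONAL — the generators are the image of a LINEAR residue map on the finite-dimensional pair section space.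
-/
import Summits.HodgeConjecture.HodgeConjecture.Theorems.R90S8ResGMidAtomArchStableU3             -- ★ p863205 (K2E1-p11): `midPoleLetter_apply_eq_of_clauses` (uniqueness of the residue value given `φ`); brings ★ `resGMidAtomGen ∕ resGMidAtom` (p862682)
import Summits.HodgeConjecture.HodgeConjecture.Theorems.R90S8ChiSectionPairFiniteDimensionalU3    -- ★ (this seat, T-disc-1 FILE 1): `finiteDimensional_chiSectionSpacePair`
import HarnessLib

/-!
# S8 #2∕#3 road (G side), T-disc-1 FILE 2 — `R90S8ResGMidAtomFiniteDimensionalU3`: `dim resGMidAtom ξ μω K′ ω ≤ dim V(χ₁, χ₂; K′, ω) < ∞` — the middle-pole residue atoms are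
# finite-dimensional (modulo double-coset representatives and Godement summability of the block's sections)

Track B ∕ R90-TF, crux h413 = `stmt-HodgeConjecture-24833`, route of record `HCCMUnconditional`; cell `hodgecm-mathlib`, R90-TF section S8 «ContSpec-n½ ∕ ResidualSpectrum», sub-socket (R)
of B ED. 5, disc half ★ p863180 `R90S8ResGMidAtomMemDiscreteOfLettersU3`, whose visible letter `hfin` (level-finiteness of the middle block `resGMidBlock ξ μω`) is paid by T-disc-1 «the
atoms `resGMidAtom ξ μω K′ ω` are finite-dimensional» (THIS FILE) + T-disc-2 «the hull's level pieces lie in the atoms» (booked).  THEOREMS ONLY (no `def`, no `instance`, no `notation`,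
no named-fact hypothesis, no `sorry`; default heartbeats); lane `--supports stmt-HodgeConjecture-24833 --as helper` (count-neutral).  CLOSES NO SOCKET.

THE MATHEMATICS ([MoeglinWaldspurger1995, I.2.17, IV.1.11, V.3.13]; [Rogawski1990, §13.9 p. 229]; [Conway1978, IV §3]).  A generator of the atom (★ D1 `resGMidAtomGen`) is an `L²` class
a.e. equal to `x ↦ Fp((out x)⁻¹)(3/2)` for continuation data `(Ec, Sp, Fp)` of a continuous section `φ ∈ V := V(ξ.bcη⁻¹·ξ.bcψ⁻¹·μω, ξ.ψ; K′, ω)`.  (i) UNIQUENESS: two data of the SAME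
`φ` have the same residue value `Fp g (3/2) = Fp′ g (3/2)` (★ `midPoleLetter_apply_eq_of_clauses`, identity theorem on the slit half-plane) — so the class is a FUNCTION of `φ`.
(ii) LINEARITY: data add and scale — `flatSectionU` is linear in `φ`, `E(f₁ + f₂) = E(f₁) + E(f₂)` on the Godement half-plane `2 < Re z` GIVEN absolute convergence of both series
(★ `eisensteinSeriesU_add`; the visible letter `hsum`, discharged for bounded sections by ★ `summable_eisensteinSeriesU_flatSectionU_cm_three`), `E(a·f) = a·E(f)` (★ `eisensteinSeriesU_smul`),
holomorphy on `{1 < Re} ∖ (Sp₁ ∪ Sp₂)`, pole letters add.  Hence the GRAPH `Gr = {(φ, f)}` of «`f` is a residue class of `φ`» is a linear subspace of `V × L²` on which the first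
projection is injective (i), so `dim Gr ≤ dim V < ∞` (★ FILE 1 `finiteDimensional_chiSectionSpacePair`, from `(B(𝔸), K′)`-double-coset representatives `s, hS`), the generators lie
in the finite-dimensional second projection of `Gr`, which is closed, so the closed span `resGMidAtom ξ μω K′ ω` lies in it: FINITE-DIMENSIONAL.
* §1 `midResidueFun_eq_of_clauses` (the residue FUNCTION `x ↦ Fp((out x)⁻¹)(3/2)` is unique given `φ`).
* §2 **`finiteDimensional_resGMidAtom_of_letters`** — THE HEAD (visible: `s, hS` double-coset representatives; `hsum` Godement summability of the block's continuous sections on `2 < Re z`).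
HONEST LABEL: HC_CM is proved only modulo the 7 printed citations (2 remaining named inputs: hLiu418 = `stmt-HodgeConjecture-24832`, h413 = `stmt-HodgeConjecture-24833`) until
rung 0 closes; REL ≠ ★ ≠ BUILT; conditional on the two visible letters; asserts no named fact and closes no socket; count-neutral.

## References
* [MoeglinWaldspurger1995] C. Mœglin, J.-L. Waldspurger, *Spectral Decomposition and Eisenstein Series* (1995), I.2.17, IV.1.11, V.3.13.
* [Rogawski1990] J. D. Rogawski, *Automorphic Representations of Unitary Groups in Three Variables* (1990), §13.9 p. 229.
* [Conway1978] J. B. Conway, *Functions of One Complex Variable* (1978), IV §3.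
-/

set_option autoImplicit false
set_option linter.dupNamespace false  -- the mandated namespace `…HodgeConjecture.HodgeConjecture.R90.S8` (LEAD #1 L1) repeats the summit's segment

noncomputable section

open MeasureTheory Measure Set Filter Topology NumberField ContRepresentation
open Literature.NumberTheory Literature.NumberTheory.Automorphic Literature.NumberTheory.Automorphic.UnitaryGroup Literature.NumberTheory.GaloisRepresentations AdelicGroupData
open Literature.NumberTheory.Automorphic.Arthur2013.Leaves.TECR Literature.NumberTheory.Rogawski1990
open Summit.HodgeConjecture.HodgeConjecture.Cruxes.H413.K2E1BorelEisensteinU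
open Summit.HodgeConjecture.HodgeConjecture.Cruxes.H413.K2E1CharacterEisensteinU3PairDefs
open Summit.HodgeConjecture.HodgeConjecture.Cruxes.H413.K2E1ChiSectionSpaceU3PairDefs
open scoped ENNReal NNReal

namespace Summit.HodgeConjecture.HodgeConjecture.R90.S8

variable (L : Type) [Field L] [NumberField L] [IsCMField L]

/-! ## §1 The residue function of a generator is unique given the section -/

/-- **The residue FUNCTION `x ↦ Fp((out x)⁻¹)(3/2)` is determined by `φ`**: two continuation data `(Ec, Sp, Fp)`, `(Ec′, Sp′, Fp′)` of the same `φ` (clauses of ★ `resGMidAtomGen`) give the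
same function on the automorphic quotient (★ `midPoleLetter_apply_eq_of_clauses` at the real point `z₀ = 3/2`). [cite: MoeglinWaldspurger1995, IV.1.11] [cite: Conway1978, IV §3] -/
theorem midResidueFun_eq_of_clauses {φ : (quasiSplit (↥(maximalRealSubfield L)) L (IsCMField.complexConj L) 3).Adelic → ℂ}
    {Ec : ℂ → (quasiSplit (↥(maximalRealSubfield L)) L (IsCMField.complexConj L) 3).Adelic → ℂ} {Sp : Finset ℂ} (hSp : ∀ s ∈ Sp, s.im = 0 ∧ 1 < s.re ∧ s.re ≤ 2)
    (hol : ∀ g, DifferentiableOn ℂ (fun z => Ec z g) ({z : ℂ | 1 < z.re} \ (↑Sp : Set ℂ)))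
    (hEc : ∀ z : ℂ, 2 < z.re → Ec z = eisensteinSeriesU (flatSectionU φ z))
    {Fp : (quasiSplit (↥(maximalRealSubfield L)) L (IsCMField.complexConj L) 3).Adelic → ℂ → ℂ} (hF : ∀ g, AnalyticAt ℂ (Fp g) ((3 : ℂ) / 2))
    (hFE : ∀ g, Fp g =ᶠ[𝓝[≠] ((3 : ℂ) / 2)] fun z => (z - (3 : ℂ) / 2) * Ec z g)
    {Ec' : ℂ → (quasiSplit (↥(maximalRealSubfield L)) L (IsCMField.complexConj L) 3).Adelic → ℂ} {Sp' : Finset ℂ} (hSp' : ∀ s ∈ Sp', s.im = 0 ∧ 1 < s.re ∧ s.re ≤ 2)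
    (hol' : ∀ g, DifferentiableOn ℂ (fun z => Ec' z g) ({z : ℂ | 1 < z.re} \ (↑Sp' : Set ℂ)))
    (hEc' : ∀ z : ℂ, 2 < z.re → Ec' z = eisensteinSeriesU (flatSectionU φ z))
    {Fp' : (quasiSplit (↥(maximalRealSubfield L)) L (IsCMField.complexConj L) 3).Adelic → ℂ → ℂ} (hF' : ∀ g, AnalyticAt ℂ (Fp' g) ((3 : ℂ) / 2))
    (hFE' : ∀ g, Fp' g =ᶠ[𝓝[≠] ((3 : ℂ) / 2)] fun z => (z - (3 : ℂ) / 2) * Ec' z g) :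
    (fun x : (quasiSplit (↥(maximalRealSubfield L)) L (IsCMField.complexConj L) 3).automorphicQuotient => Fp (Quotient.out (x : ((quasiSplit (↥(maximalRealSubfield L)) L (IsCMField.complexConj L) 3).Adelic ⧸ (quasiSplit (↥(maximalRealSubfield L)) L (IsCMField.complexConj L) 3).quotientSubgroup)))⁻¹ ((3 : ℂ) / 2)) = (fun x : (quasiSplit (↥(maximalRealSubfield L)) L (IsCMField.complexConj L) 3).automorphicQuotient => Fp' (Quotient.out (x : ((quasiSplit (↥(maximalRealSubfield L)) L (IsCMField.complexConj L) 3).Adelic ⧸ (quasiSplit (↥(maximalRealSubfield L)) L (IsCMField.complexConj L) 3).quotientSubgroup)))⁻¹ ((3 : ℂ) / 2)) := by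
  funext x
  exact midPoleLetter_apply_eq_of_clauses L (fun s hs => (hSp s hs).1) (fun s hs => (hSp' s hs).1) hol hEc hol' hEc' (z₀ := (3 : ℂ) / 2) (by norm_num) (by norm_num) hF hFE hF' hFE' _

/-! ## §2 The atoms are finite-dimensional -/

section Atom

variable (μ : Measure (quasiSplit (↥(maximalRealSubfield L)) L (IsCMField.complexConj L) 3).automorphicQuotient)
  (ξ : OneDimAutRepH L) (μω : HeckeCharacter L) (K' : Subgroup (quasiSplit (↥(maximalRealSubfield L)) L (IsCMField.complexConj L) 3).Adelic) (ω : ↥K' →* ℂ)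

/-- **T-disc-1: THE MIDDLE-POLE RESIDUE ATOM `resGMidAtom ξ μω K′ ω` IS FINITE-DIMENSIONAL.**  Visible letters: a finite family `s : ι → G(𝔸)` of `(B(𝔸), K′)`-double-coset representatives
(`hS`; ★ Iwasawa at the CM pair supplies them for compact open `K′`) and `hsum`, the absolute convergence of `E(flatSectionU φ z)` for `2 < Re z` for the block's continuous sections
(★ `summable_eisensteinSeriesU_flatSectionU_cm_three` for bounded `φ`).  Proof: graph of the residue relation is a linear subspace of `V × L²` (linearity of data, `hsum`), first projection
injective (§1), `V` finite-dimensional (★ FILE 1), generators in the closed finite-dimensional second projection. [cite: MoeglinWaldspurger1995, I.2.17, V.3.13] [cite: Rogawski1990, §13.9 p. 229] -/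
theorem finiteDimensional_resGMidAtom_of_letters {ι : Type*} [Finite ι] (s : ι → (quasiSplit (↥(maximalRealSubfield L)) L (IsCMField.complexConj L) 3).Adelic)
    (hS : ∀ g : (quasiSplit (↥(maximalRealSubfield L)) L (IsCMField.complexConj L) 3).Adelic, ∃ b ∈ borelAdelic (↥(maximalRealSubfield L)) L (IsCMField.complexConj L) 3, ∃ i : ι, ∃ k : ↥K', g = b * s i * (k : (quasiSplit (↥(maximalRealSubfield L)) L (IsCMField.complexConj L) 3).Adelic))
    (hsum : ∀ φ ∈ chiSectionSpacePair (ξ.bcη⁻¹ * ξ.bcψ⁻¹ * μω) ξ.ψ K' (ω : ↥K' → ℂ), Continuous φ → ∀ z : ℂ, 2 < z.re → ∀ g : (quasiSplit (↥(maximalRealSubfield L)) L (IsCMField.complexConj L) 3).Adelic,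
      Summable fun q : Quotient (MulAction.orbitRel ↥(borelU ((IsCMField.complexConj L : L ≃ₐ[↥(maximalRealSubfield L)] L) : L →+* L) ((StdForm.antidiagonal 3).over L)) ↥(unitaryGroupOfForm ((IsCMField.complexConj L : L ≃ₐ[↥(maximalRealSubfield L)] L) : L →+* L) ((StdForm.antidiagonal 3).over L))) =>
        ‖flatSectionU φ z ((quasiSplit (↥(maximalRealSubfield L)) L (IsCMField.complexConj L) 3).toAdelic (Quotient.out q : ↥(unitaryGroupOfForm ((IsCMField.complexConj L : L ≃ₐ[↥(maximalRealSubfield L)] L) : L →+* L) ((StdForm.antidiagonal 3).over L))) * g)‖) :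
    FiniteDimensional ℂ ↥(resGMidAtom L μ ξ μω K' ω) := by
  haveI hV : FiniteDimensional ℂ ↥(chiSectionSpacePair (ξ.bcη⁻¹ * ξ.bcψ⁻¹ * μω) ξ.ψ K' (ω : ↥K' → ℂ)) := finiteDimensional_chiSectionSpacePair s hS
  -- the graph of «`f` is a residue class of the continuous section `φ`»
  set Gr : Submodule ℂ (((quasiSplit (↥(maximalRealSubfield L)) L (IsCMField.complexConj L) 3).Adelic → ℂ) × (quasiSplit (↥(maximalRealSubfield L)) L (IsCMField.complexConj L) 3).L2 μ) :=
    { carrier := {p | p.1 ∈ chiSectionSpacePair (ξ.bcη⁻¹ * ξ.bcψ⁻¹ * μω) ξ.ψ K' (ω : ↥K' → ℂ) ∧ Continuous p.1 ∧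
        ∃ (Ec : ℂ → (quasiSplit (↥(maximalRealSubfield L)) L (IsCMField.complexConj L) 3).Adelic → ℂ) (Sp : Finset ℂ)
          (_ : ∀ s ∈ Sp, s.im = 0 ∧ 1 < s.re ∧ s.re ≤ 2)
          (_ : ∀ g, DifferentiableOn ℂ (fun z => Ec z g) ({z : ℂ | 1 < z.re} \ (↑Sp : Set ℂ)))
          (_ : ∀ z : ℂ, 2 < z.re → Ec z = eisensteinSeriesU (flatSectionU p.1 z))
          (Fp : (quasiSplit (↥(maximalRealSubfield L)) L (IsCMField.complexConj L) 3).Adelic → ℂ → ℂ)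
          (_ : ∀ g, AnalyticAt ℂ (Fp g) ((3 : ℂ) / 2))
          (_ : ∀ g, Fp g =ᶠ[𝓝[≠] ((3 : ℂ) / 2)] fun z => (z - (3 : ℂ) / 2) * Ec z g),
          (p.2 : (quasiSplit (↥(maximalRealSubfield L)) L (IsCMField.complexConj L) 3).automorphicQuotient → ℂ) =ᵐ[μ] (fun x : (quasiSplit (↥(maximalRealSubfield L)) L (IsCMField.complexConj L) 3).automorphicQuotient => Fp (Quotient.out (x : ((quasiSplit (↥(maximalRealSubfield L)) L (IsCMField.complexConj L) 3).Adelic ⧸ (quasiSplit (↥(maximalRealSubfield L)) L (IsCMField.complexConj L) 3).quotientSubgroup)))⁻¹ ((3 : ℂ) / 2))}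
      add_mem' := by
        rintro ⟨φ₁, f₁⟩ ⟨φ₂, f₂⟩ ⟨hφ₁, hc₁, Ec₁, Sp₁, hSp₁, hol₁, hEc₁, Fp₁, hF₁, hFE₁, hae₁⟩ ⟨hφ₂, hc₂, Ec₂, Sp₂, hSp₂, hol₂, hEc₂, Fp₂, hF₂, hFE₂, hae₂⟩
        simp only at hφ₁ hc₁ hEc₁ hae₁ hφ₂ hc₂ hEc₂ hae₂
        refine ⟨Submodule.add_mem _ hφ₁ hφ₂, hc₁.add hc₂, fun z g => Ec₁ z g + Ec₂ z g, Sp₁ ∪ Sp₂, fun t ht => ?_, fun g => ?_, fun z hz => ?_,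
          fun g z => Fp₁ g z + Fp₂ g z, fun g => (hF₁ g).add (hF₂ g), fun g => ?_, ?_⟩
        · rcases Finset.mem_union.1 ht with h | h
          · exact hSp₁ t h
          · exact hSp₂ t h
        · have h1 := (hol₁ g).mono (Set.sdiff_subset_sdiff_right (Finset.coe_subset.2 Finset.subset_union_left) : ({z : ℂ | 1 < z.re} \ (↑(Sp₁ ∪ Sp₂) : Set ℂ)) ⊆ {z : ℂ | 1 < z.re} \ (↑Sp₁ : Set ℂ))
          have h2 := (hol₂ g).mono (Set.sdiff_subset_sdiff_right (Finset.coe_subset.2 Finset.subset_union_right) : ({z : ℂ | 1 < z.re} \ (↑(Sp₁ ∪ Sp₂) : Set ℂ)) ⊆ {z : ℂ | 1 < z.re} \ (↑Sp₂ : Set ℂ))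
          exact h1.add h2
        · funext g
          have hflat : flatSectionU (φ₁ + φ₂) z = flatSectionU φ₁ z + flatSectionU φ₂ z := by
            funext y
            simp only [flatSectionU_apply, Pi.add_apply, add_mul]
          show Ec₁ z g + Ec₂ z g = eisensteinSeriesU (flatSectionU (φ₁ + φ₂) z) g
          rw [hflat, eisensteinSeriesU_add ((hsum φ₁ hφ₁ hc₁ z hz g).of_norm) ((hsum φ₂ hφ₂ hc₂ z hz g).of_norm), hEc₁ z hz, hEc₂ z hz]
        · filter_upwards [hFE₁ g, hFE₂ g] with w h1 h2
          rw [h1, h2, mul_add]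
        · filter_upwards [hae₁, hae₂, Lp.coeFn_add f₁ f₂] with x h1 h2 h12
          show ((f₁ + f₂ : (quasiSplit (↥(maximalRealSubfield L)) L (IsCMField.complexConj L) 3).L2 μ) : (quasiSplit (↥(maximalRealSubfield L)) L (IsCMField.complexConj L) 3).automorphicQuotient → ℂ) x = _
          rw [h12, Pi.add_apply, h1, h2]
      zero_mem' := by
        refine ⟨Submodule.zero_mem _, continuous_const, fun _ _ => 0, ∅, fun t ht => (Finset.notMem_empty t ht).elim, fun g => ?_, fun z hz => ?_,
          fun _ _ => 0, fun g => analyticAt_const, fun g => Eventually.of_forall fun w => by simp, ?_⟩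
        · exact differentiableOn_const 0
        · funext g
          have hflat : flatSectionU (0 : (quasiSplit (↥(maximalRealSubfield L)) L (IsCMField.complexConj L) 3).Adelic → ℂ) z = 0 := by
            funext y
            simp only [flatSectionU_apply, Pi.zero_apply, zero_mul]
          show (0 : ℂ) = eisensteinSeriesU (flatSectionU (0 : (quasiSplit (↥(maximalRealSubfield L)) L (IsCMField.complexConj L) 3).Adelic → ℂ) z) g
          rw [hflat]
          simp only [eisensteinSeriesU, Pi.zero_apply, tsum_zero]
        · filter_upwards [Lp.coeFn_zero (E := ℂ) (p := 2) (μ := μ)] with x hx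
          show ((0 : (quasiSplit (↥(maximalRealSubfield L)) L (IsCMField.complexConj L) 3).L2 μ) : (quasiSplit (↥(maximalRealSubfield L)) L (IsCMField.complexConj L) 3).automorphicQuotient → ℂ) x = _
          rw [hx, Pi.zero_apply]
      smul_mem' := by
        rintro a ⟨φ, f⟩ ⟨hφ, hc, Ec, Sp, hSp, hol, hEc, Fp, hF, hFE, hae⟩
        simp only at hφ hc hEc hae
        refine ⟨Submodule.smul_mem _ a hφ, hc.const_smul a, fun z g => a * Ec z g, Sp, hSp, fun g => (hol g).const_mul a, fun z hz => ?_,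
          fun g z => a * Fp g z, fun g => analyticAt_const.mul (hF g), fun g => ?_, ?_⟩
        · funext g
          have hflat : flatSectionU (a • φ) z = a • flatSectionU φ z := by
            funext y
            simp only [flatSectionU_apply, Pi.smul_apply, smul_eq_mul, mul_assoc]
          show a * Ec z g = eisensteinSeriesU (flatSectionU (a • φ) z) g
          rw [hflat, eisensteinSeriesU_smul, hEc z hz]
        · filter_upwards [hFE g] with w h
          show a * Fp g w = (w - (3 : ℂ) / 2) * (a * Ec w g)
          rw [h]
          ring
        · filter_upwards [hae, Lp.coeFn_smul a f] with x h hs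
          show ((a • f : (quasiSplit (↥(maximalRealSubfield L)) L (IsCMField.complexConj L) 3).L2 μ) : (quasiSplit (↥(maximalRealSubfield L)) L (IsCMField.complexConj L) 3).automorphicQuotient → ℂ) x = _
          rw [hs, Pi.smul_apply, h, smul_eq_mul] } with hGr
  -- (i) the first projection is injective on the graph: the class is a function of the section
  have hinj : ∀ p ∈ Gr, ∀ p' ∈ Gr, p.1 = p'.1 → p.2 = p'.2 := by
    rintro ⟨φ, f⟩ ⟨hφ, hc, Ec, Sp, hSp, hol, hEc, Fp, hF, hFE, hae⟩ ⟨φ', f'⟩ ⟨hφ', hc', Ec', Sp', hSp', hol', hEc', Fp', hF', hFE', hae'⟩ hpp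
    simp only at hpp hae hae' ⊢
    subst hpp
    refine Lp.ext (hae.trans (Eventually.of_forall fun x => ?_) |>.trans hae'.symm)
    exact congrFun (midResidueFun_eq_of_clauses L hSp hol hEc hF hFE hSp' hol' hEc' hF' hFE') x
  -- hence `Gr` is finite-dimensional: it injects linearly into `V`
  set P : ↥Gr →ₗ[ℂ] ↥(chiSectionSpacePair (ξ.bcη⁻¹ * ξ.bcψ⁻¹ * μω) ξ.ψ K' (ω : ↥K' → ℂ)) :=
    { toFun := fun p => ⟨p.1.1, p.2.1⟩
      map_add' := fun p p' => rfl
      map_smul' := fun a p => rfl } with hP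
  have hPinj : Function.Injective P := by
    intro p p' h
    have h1 : p.1.1 = p'.1.1 := congrArg Subtype.val h
    exact Subtype.ext (Prod.ext h1 (hinj p.1 p.2 p'.1 p'.2 h1))
  haveI hGrfd : FiniteDimensional ℂ ↥Gr := FiniteDimensional.of_injective P hPinj
  -- the generators lie in the (finite-dimensional, hence closed) second projection of the graph
  set M : Submodule ℂ ((quasiSplit (↥(maximalRealSubfield L)) L (IsCMField.complexConj L) 3).L2 μ) := Gr.map (LinearMap.snd ℂ ((quasiSplit (↥(maximalRealSubfield L)) L (IsCMField.complexConj L) 3).Adelic → ℂ) ((quasiSplit (↥(maximalRealSubfield L)) L (IsCMField.complexConj L) 3).L2 μ)) with hM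
  haveI hMfd : FiniteDimensional ℂ ↥M := inferInstance
  have hgen : resGMidAtomGen L μ ξ μω K' ω ⊆ (M : Set ((quasiSplit (↥(maximalRealSubfield L)) L (IsCMField.complexConj L) 3).L2 μ)) := by
    rintro f ⟨φ, hφ, hc, Ec, Sp, hSp, hol, hEc, Fp, hF, hFE, hae⟩
    exact Submodule.mem_map.2 ⟨(φ, f), ⟨hφ, hc, Ec, Sp, hSp, hol, hEc, Fp, hF, hFE, hae⟩, rfl⟩
  have hle : resGMidAtom L μ ξ μω K' ω ≤ M := by
    rw [resGMidAtom_def]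
    exact Submodule.topologicalClosure_minimal _ (Submodule.span_le.2 hgen) (Submodule.closed_of_finiteDimensional M)
  exact Submodule.finiteDimensional_of_le hle

end Atom

end Summit.HodgeConjecture.HodgeConjecture.R90.S8

end
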